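import Literature.NumberTheory.Automorphic.OpenCellCoinvariants
import HarnessLib

/-!
# Standard sections of the open cell: translation by `P'`-normalisers and the finite-sum decomposition

Topic `NumberTheory/Automorphic`; theorems only, continuing `OpenCellSections` / `OpenCellCoinvariants`
(monotone block labelling `c`, `P = P_c`, open cell `P w₀ N'`, standard sections `Φ_{K,w}`):

* `smoothIndRep_cellSection_of_conj_mem` — **right translation by `m ∈ P'` with `w₀ m w₀⁻¹ ∈ P_c`**
  (e.g. block diagonal elements of the Levi of the reversed parabolic, not only `m ∈ A'` as in
  `smoothIndRep_levi_cellSection`): `m · Φ_{K,w} = Φ_{m K m⁻¹, σ'(w₀ m w₀⁻¹) w}`;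
* `exists_eq_sum_cellSection` — **the decomposition of the open-cell part**: every `f ∈ I_open`
  fixed by a compact open `K' ≤ N'` is a finite sum `∑_{r ∈ R} r⁻¹ · Φ_{r K' r⁻¹, f(w₀ r)}` (the
  statement underlying `mk_mem_span_range_mk_cellSection`, recorded as an equality of vectors so that
  it can be pushed into other coinvariant spaces than the Whittaker one).

(Bernstein–Zelevinsky 1977, Thm. 5.2, the open orbit; 1976, §2.22–2.25.)

## References

* I. N. Bernstein, A. V. Zelevinsky, *Induced representations of reductive `p`-adic groups I*,
  Ann. Sci. ÉNS 10 (1977), Thm. 5.2. [BernsteinZelevinskyASENS1977]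
* I. N. Bernstein, A. V. Zelevinsky, *Representations of the group GL(n, F) where F is a
  non-archimedean local field*, Russian Math. Surveys 31:3 (1976), §2.22–2.25. [BernsteinZelevinskyRMS1976]
-/

noncomputable section

namespace Literature.NumberTheory.Automorphic

variable {F : Type*} [Field F] [ValuativeRel F] [TopologicalSpace F] [IsNonarchimedeanLocalField F]
  {n : ℕ} {α : Type*} [LinearOrder α] [Fintype α] {c : Fin n → α}
  {W : Type*} [AddCommGroup W] [Module ℂ W]
  (σ' : Representation ℂ ↥(standardParabolicGL F c) W)

/-- **Right translation of `Φ_{K,w}` by `m ∈ P'` with `w₀ m w₀⁻¹ ∈ P_c`** (e.g. a block diagonal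
element of the Levi of `P'`): `m · Φ_{K,w} = Φ_{m K m⁻¹, σ'(w₀ m w₀⁻¹) w}`
(since `p w₀ n' m = (p · w₀ m w₀⁻¹) · w₀ · (m⁻¹ n' m)`). [cite: BernsteinZelevinskyASENS1977, Thm. 5.2] -/
theorem smoothIndRep_cellSection_of_conj_mem (hc : Monotone c) (hσ' : σ'.IsSmooth)
    (K : Subgroup ↥(oppositeCellRadical (K := F) c)) (hKo : IsOpen (K : Set ↥(oppositeCellRadical (K := F) c)))
    (hKc : IsCompact (K : Set ↥(oppositeCellRadical (K := F) c))) (w : W)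
    {m : GL (Fin n) F} (hmP' : m ∈ standardParabolicGL F (⇑OrderDual.toDual ∘ revLabel c))
    (hmP : permGL Fin.revPerm * m * (permGL Fin.revPerm)⁻¹ ∈ standardParabolicGL F c) :
    Representation.smoothIndRep (standardParabolicGL F c) σ' m (cellSection σ' hc hσ' K hKo hKc w) =
      cellSection σ' hc hσ' (conjSubgroup hmP' K) (isOpen_conjSubgroup _ hKo) (isCompact_conjSubgroup _ hKc)
        (σ' ⟨permGL Fin.revPerm * m * (permGL Fin.revPerm)⁻¹, hmP⟩ w) := by
  -- the inverse satisfies the same hypotheses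
  have hmP'i : m⁻¹ ∈ standardParabolicGL F (⇑OrderDual.toDual ∘ revLabel c) := Subgroup.inv_mem _ hmP'
  have hmPi : permGL Fin.revPerm * m⁻¹ * (permGL Fin.revPerm)⁻¹ ∈ standardParabolicGL F c := by
    have : permGL Fin.revPerm * m⁻¹ * (permGL Fin.revPerm)⁻¹ =
        (permGL Fin.revPerm * m * (permGL Fin.revPerm)⁻¹)⁻¹ := by group
    rw [this]
    exact Subgroup.inv_mem _ hmP
  -- the cell is stable under right translation by such `m`
  have hstab : ∀ {m : GL (Fin n) F}, m ∈ standardParabolicGL F (⇑OrderDual.toDual ∘ revLabel c) →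
      permGL Fin.revPerm * m * (permGL Fin.revPerm)⁻¹ ∈ standardParabolicGL F c →
      ∀ {g : GL (Fin n) F}, g ∈ parabolicDoubleCoset (K := F) c Fin.revPerm →
        g * m ∈ parabolicDoubleCoset (K := F) c Fin.revPerm := by
    intro m hmP' hmP g hg
    obtain ⟨p, hp, n', hn', rfl⟩ := (mem_parabolicDoubleCoset_rev_iff c hc g).1 hg
    have e : p * permGL Fin.revPerm * n' * m =
        (p * (permGL Fin.revPerm * m * (permGL Fin.revPerm)⁻¹)) * permGL Fin.revPerm * (m⁻¹ * n' * m) := by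
      group
    rw [e]
    exact parabolic_mul_w₀_mul_mem hc (Subgroup.mul_mem _ hp hmP)
      (inv_mul_mul_mem_oppositeCellRadical_of_mem hmP' hn')
  apply Representation.SmoothInd.ext
  funext g
  rw [Representation.toFun_smoothIndRep_apply, toFun_cellSection, toFun_cellSection]
  by_cases hg : g ∈ parabolicDoubleCoset (K := F) c Fin.revPerm
  · obtain ⟨p, hp, n', hn', rfl⟩ := (mem_parabolicDoubleCoset_rev_iff c hc g).1 hg
    have hn'' : m⁻¹ * n' * m ∈ oppositeCellRadical (K := F) c :=
      inv_mul_mul_mem_oppositeCellRadical_of_mem hmP' hn'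
    have e : p * permGL Fin.revPerm * n' * m =
        (p * (permGL Fin.revPerm * m * (permGL Fin.revPerm)⁻¹)) * permGL Fin.revPerm * (m⁻¹ * n' * m) := by
      group
    rw [e]
    have hiff : (⟨m⁻¹ * n' * m, hn''⟩ : ↥(oppositeCellRadical (K := F) c)) ∈ K ↔
        (⟨n', hn'⟩ : ↥(oppositeCellRadical (K := F) c)) ∈ conjSubgroup hmP' K := by
      rw [mem_conjSubgroup_iff]
      exact Iff.of_eq (congrArg (· ∈ K) (Subtype.ext (by simp only [coe_radicalConj_symm])).symm)
    by_cases hK : (⟨m⁻¹ * n' * m, hn''⟩ : ↥(oppositeCellRadical (K := F) c)) ∈ K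
    · rw [cellSectionFun_eq_of_mem hc w (Subgroup.mul_mem _ hp hmP) hn'' hK,
        cellSectionFun_eq_of_mem hc _ hp hn' (hiff.1 hK), ← Module.End.mul_apply, ← map_mul]
      rfl
    · rw [cellSectionFun_eq_zero_of_not_mem hc w (Subgroup.mul_mem _ hp hmP) hn'' hK,
        cellSectionFun_eq_zero_of_not_mem hc _ hp hn' (fun h => hK (hiff.2 h))]
  · have hgm : g * m ∉ parabolicDoubleCoset (K := F) c Fin.revPerm := fun h => hg (by
      have := hstab hmP'i hmPi h
      rwa [mul_inv_cancel_right] at this)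
    rw [cellSectionFun_of_not_mem hc _ w hgm, cellSectionFun_of_not_mem hc _ _ hg]

/-- **Decomposition of the open-cell part into translates of standard sections** (the finite-sum
statement underlying `mk_mem_span_range_mk_cellSection`): if `f ∈ I_open` is fixed by the compact
open subgroup `K' ≤ N'`, then `f = ∑_{r ∈ R} r⁻¹ · Φ_{r K' r⁻¹, f(w₀ r)}` for a finite `R ⊆ N'`
(the support of `n' ↦ f(w₀ n')` is compact and `f(w₀ n')` is constant on the cosets `r K'`).
(Bernstein–Zelevinsky 1977, Thm. 5.2, open orbit.) [cite: BernsteinZelevinskyASENS1977, Thm. 5.2] -/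
theorem exists_eq_sum_cellSection (hc : Monotone c) (hσ' : σ'.IsSmooth)
    (K' : Subgroup ↥(oppositeCellRadical (K := F) c)) (hK'o : IsOpen (K' : Set ↥(oppositeCellRadical (K := F) c)))
    (hK'c : IsCompact (K' : Set ↥(oppositeCellRadical (K := F) c)))
    (f : Representation.SmoothInd (standardParabolicGL F c) σ')
    (hf : f ∈ vanishingOn (standardParabolicGL F c) σ' (cellLT (K := F) c Fin.revPerm))
    (hK'stab : ∀ k ∈ K', ∀ x : GL (Fin n) F, f.toFun (x * (k : GL (Fin n) F)) = f.toFun x) :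
    ∃ R : Finset ↥(oppositeCellRadical (K := F) c),
      f = ∑ r ∈ R, Representation.smoothIndRep (standardParabolicGL F c) σ' ((r : GL (Fin n) F))⁻¹
        (cellSection σ' hc hσ' (conjSubgroup (oppositeCellRadical_le_reversedParabolic c r.2) K')
          (isOpen_conjSubgroup _ hK'o) (isCompact_conjSubgroup _ hK'c)
          (f.toFun (permGL Fin.revPerm * (r : GL (Fin n) F)))) := by
  classical
  haveI : T2Space F := (GaloisRepresentations.IsNonarchimedeanLocalField.isLocalField F).toT2Space
  -- Step 1: the support of `u ↦ f (w₀ u)` modulo `A'`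
  have hPinv : ∀ p ∈ standardParabolicGL F c, ∀ g, f.toFun (p * g) ≠ 0 ↔ f.toFun g ≠ 0 := by
    intro p hp g
    rw [show p * g = ((⟨p, hp⟩ : ↥(standardParabolicGL F c)) : GL (Fin n) F) * g from rfl,
      Representation.SmoothInd.toFun_subgroup_mul, not_iff_not]
    constructor
    · intro h
      have := congrArg (σ' (⟨p, hp⟩ : ↥(standardParabolicGL F c))⁻¹) h
      rwa [map_zero, ← Module.End.mul_apply, ← map_mul, inv_mul_cancel, map_one,
        Module.End.one_apply] at this
    · intro h
      rw [h, map_zero]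
  obtain ⟨C, hC, hCsupp⟩ := exists_isCompact_support_of_eq_zero_on_cellLT (F := F) c hc Fin.revPerm f.toFun
    (Representation.SmoothInd.isClosed_setOf_toFun_ne_zero f) hPinv hf
  -- Step 2: the support of `n' ↦ f (w₀ n')` on `N'` lies in the compact `C' = n(C)`
  have hsupp : ∀ x : ↥(oppositeCellRadical (K := F) c), f.toFun (permGL Fin.revPerm * (x : GL (Fin n) F)) ≠ 0 →
      (x : GL (Fin n) F) ∈ (cellRadicalPart (K := F) c hc) '' C := by
    intro x hx
    obtain ⟨v, hvC, ha⟩ := hCsupp ⟨x, oppositeCellRadical_le c hc x.2⟩ hx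
    set a : ↥(upperUnitriangular (Fin n) F) := ⟨x, oppositeCellRadical_le c hc x.2⟩ * v⁻¹ with ha_def
    have haA : (a : GL (Fin n) F) ∈ cellLeviUnipotent (K := F) c :=
      (mem_cellLeviUnipotent_iff_conj_mem c _).2 ⟨a.2, ha⟩
    refine ⟨v, hvC, ?_⟩
    have hv : v = ⟨(a : GL (Fin n) F)⁻¹ * x, Subgroup.mul_mem _ (Subgroup.inv_mem _ a.2)
        (oppositeCellRadical_le c hc x.2)⟩ := Subtype.ext (by
      have e : (a : GL (Fin n) F) = (x : GL (Fin n) F) * (v : GL (Fin n) F)⁻¹ := rfl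
      show (v : GL (Fin n) F) = (a : GL (Fin n) F)⁻¹ * x
      rw [e]
      group)
    rw [hv]
    exact cellRadicalPart_eq_of_mem c hc (Subgroup.inv_mem _ haA) x.2
  -- Step 3: a compact open subgroup `L'` of `N'` containing the support and `K'`
  have hC'' : IsCompact ((Subtype.val : ↥(oppositeCellRadical (K := F) c) → GL (Fin n) F) ⁻¹'
      ((cellRadicalPart (K := F) c hc) '' C)) :=
    (isClosed_oppositeCellRadical (c := c)).isClosedEmbedding_subtypeVal.isCompact_preimage
      (hC.image (continuous_cellRadicalPart c hc))
  have hlim : IsLimitOfCompactOpen ↥(oppositeCellRadical (K := F) c) :=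
    isLimitOfCompactOpen_unipotentRadicalGL F (⇑OrderDual.toDual ∘ revLabel c) (monotone_toDual_revLabel c hc)
  obtain ⟨L', hL'o, hL'c, hL'sub⟩ := hlim _ (hC''.union hK'c)
  have hK'L' : K' ≤ L' := fun x hx => hL'sub (Or.inr hx)
  have hsuppL' : ∀ x : ↥(oppositeCellRadical (K := F) c), f.toFun (permGL Fin.revPerm * (x : GL (Fin n) F)) ≠ 0 → x ∈ L' :=
    fun x hx => hL'sub (Or.inl (hsupp x hx))
  -- Step 4: a transversal of `L' / K'` and the decomposition of `f`
  obtain ⟨R, hR⟩ := exists_isLeftTransversal (B := L') hL'c hK'o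
  rw [inf_eq_right.2 hK'L'] at hR
  have hrP' : ∀ r : ↥(oppositeCellRadical (K := F) c), (r : GL (Fin n) F) ∈ standardParabolicGL F (⇑OrderDual.toDual ∘ revLabel c) :=
    fun r => oppositeCellRadical_le_reversedParabolic c r.2
  refine ⟨R, ?_⟩
  set Φr : ↥(oppositeCellRadical (K := F) c) → Representation.SmoothInd (standardParabolicGL F c) σ' := fun r =>
    Representation.smoothIndRep (standardParabolicGL F c) σ' ((r : GL (Fin n) F))⁻¹
      (cellSection σ' hc hσ' (conjSubgroup (hrP' r) K') (isOpen_conjSubgroup _ hK'o) (isCompact_conjSubgroup _ hK'c)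
        (f.toFun (permGL Fin.revPerm * (r : GL (Fin n) F)))) with hΦr
  show f = ∑ r ∈ R, Φr r
  apply Representation.SmoothInd.ext
  funext g
  rw [Representation.SmoothInd.toFun_sum]
  by_cases hg : g ∈ parabolicDoubleCoset (K := F) c Fin.revPerm
  · obtain ⟨p, hp, n', hn', rfl⟩ := (mem_parabolicDoubleCoset_rev_iff c hc g).1 hg
    have hterm : ∀ r ∈ R, (Φr r).toFun (p * permGL Fin.revPerm * n') =
        if r⁻¹ * ⟨n', hn'⟩ ∈ K' then σ' ⟨p, hp⟩ (f.toFun (permGL Fin.revPerm * (r : GL (Fin n) F))) else 0 := by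
      intro r _
      simp only [hΦr, Representation.toFun_smoothIndRep_apply, toFun_cellSection]
      have hmem : n' * ((r : GL (Fin n) F))⁻¹ ∈ oppositeCellRadical (K := F) c :=
        Subgroup.mul_mem _ hn' (Subgroup.inv_mem _ r.2)
      have e : p * permGL Fin.revPerm * n' * ((r : GL (Fin n) F))⁻¹ = p * permGL Fin.revPerm * (n' * ((r : GL (Fin n) F))⁻¹) := by
        group
      have hiff : (⟨n' * ((r : GL (Fin n) F))⁻¹, hmem⟩ : ↥(oppositeCellRadical (K := F) c)) ∈ conjSubgroup (hrP' r) K' ↔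
          r⁻¹ * ⟨n', hn'⟩ ∈ K' := by
        rw [mem_conjSubgroup_iff]
        have : (radicalConj (hrP' r)).symm ⟨n' * ((r : GL (Fin n) F))⁻¹, hmem⟩ = r⁻¹ * ⟨n', hn'⟩ :=
          Subtype.ext (by simp only [coe_radicalConj_symm, Subgroup.coe_mul, InvMemClass.coe_inv]; group)
        rw [this]
      rw [e]
      split_ifs with h
      · exact cellSectionFun_eq_of_mem hc _ hp hmem (hiff.2 h)
      · exact cellSectionFun_eq_zero_of_not_mem hc _ hp hmem (fun h' => h (hiff.1 h'))
    rw [Finset.sum_congr rfl hterm,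
      show f.toFun (p * permGL Fin.revPerm * n') = σ' ⟨p, hp⟩ (f.toFun (permGL Fin.revPerm * n')) by
        rw [mul_assoc]; exact Representation.SmoothInd.toFun_subgroup_mul f ⟨p, hp⟩ _]
    by_cases hL : (⟨n', hn'⟩ : ↥(oppositeCellRadical (K := F) c)) ∈ L'
    · obtain ⟨r₀, ⟨hr₀R, hr₀⟩, huniq⟩ := hR.existsUnique _ hL
      rw [Finset.sum_eq_single r₀]
      · rw [if_pos hr₀]
        congr 1
        have : permGL Fin.revPerm * n' = permGL Fin.revPerm * (r₀ : GL (Fin n) F) *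
            (((r₀⁻¹ * ⟨n', hn'⟩ : ↥(oppositeCellRadical (K := F) c))) : GL (Fin n) F) := by
          simp only [Subgroup.coe_mul, InvMemClass.coe_inv]
          group
        rw [this, hK'stab _ hr₀]
      · intro r hrR hne
        rw [if_neg]
        exact fun h => hne (huniq r ⟨hrR, h⟩)
      · intro h
        exact absurd hr₀R h
    · have h0 : f.toFun (permGL Fin.revPerm * n') = 0 := by
        by_contra h
        exact hL (hsuppL' ⟨n', hn'⟩ h)
      rw [h0, map_zero]
      symm
      refine Finset.sum_eq_zero fun r hr => ?_
      rw [if_neg]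
      intro h
      apply hL
      have : (⟨n', hn'⟩ : ↥(oppositeCellRadical (K := F) c)) = r * (r⁻¹ * ⟨n', hn'⟩) := by group
      rw [this]
      exact L'.mul_mem (hR.mem_of_mem r hr) (hK'L' h)
  · have hg' : g ∈ cellLT (K := F) c Fin.revPerm := by
      have := Set.eq_univ_iff_forall.1 (cellLT_rev_union (K := F) c hc) g
      exact this.resolve_right hg
    rw [hf g hg']
    symm
    refine Finset.sum_eq_zero fun r _ => ?_
    simp only [hΦr, Representation.toFun_smoothIndRep_apply, toFun_cellSection]
    refine cellSectionFun_of_not_mem hc _ _ fun h => hg ?_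
    exact mem_parabolicDoubleCoset_rev_of_mul_mem h (Subgroup.inv_mem _ (oppositeCellRadical_le c hc r.2))

end Literature.NumberTheory.Automorphic

end
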